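import Mathlib

/-!
# Route `LeeYangFibres`, support `HyperbolicityClipsParity` (stmt-Parity-14114): the Newton step

Helper file 1/·: **log-concavity of the coefficients of a real-rooted polynomial with non-negative
coefficients** — the only consequence of hyperbolicity the clipping lemma uses
(`p_m² ≥ p_{m-1} p_{m+1}` at two bulk indices of every fibre polynomial).

We avoid the general Newton inequalities (Maclaurin normalisation) and prove the special case we
need directly: a polynomial `P ∈ ℝ[X]` with non-negative coefficients all of whose complex roots are
real splits over `ℝ` with roots `≤ 0`, i.e. `P = a · ∏ (X + s)` with `a ≥ 0`, `s ≥ 0`, and the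
STRONG log-concavity `p_j p_{k+2} ≤ p_{j+1} p_{k+1}` (`j ≤ k`) of the coefficient sequence is
preserved under multiplication by `X + s`, `s ≥ 0` (a three-term identity), starting from the
constant `a`. The packaged form `newton_filter_sum_sq` speaks about a finite family of monomials
`c_j X^{e_j}`, which is how the fibre polynomials of `FibreHyperbolicity` arise.

References: classical (Newton 1707; Hardy–Littlewood–Pólya, *Inequalities*, §2.22, Thm. 51 and §4;
J. M. Steele, *The Cauchy–Schwarz Master Class*, Problem 12.1). No named facts are used.
-/

namespace Summit.Parity.GeneralizedHardyLittlewood.Theorems.HyperbolicityClipsParity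

open Polynomial

/-- Coefficients of `q · (X + C r)`: degree `0`. -/
theorem coeff_mul_X_add_C_zero (q : ℝ[X]) (r : ℝ) : (q * (X + C r)).coeff 0 = r * q.coeff 0 := by
  rw [mul_add, coeff_add, mul_coeff_zero, coeff_X_zero, mul_zero, zero_add, coeff_mul_C, mul_comm]

/-- Coefficients of `q · (X + C r)`: degree `n + 1`. -/
theorem coeff_mul_X_add_C_succ (q : ℝ[X]) (r : ℝ) (n : ℕ) :
    (q * (X + C r)).coeff (n + 1) = q.coeff n + r * q.coeff (n + 1) := by
  rw [mul_add, coeff_add, coeff_mul_X, coeff_mul_C, mul_comm r]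

/-- **The inductive step.** Non-negativity and strong log-concavity
`q_j q_{j+l+2} ≤ q_{j+1} q_{j+l+1}` of the coefficients pass from `q` to `q · (X + r)` for `r ≥ 0`:
`p_j p_{j+l+2} - p_{j+1}p_{j+l+1}` is minus a combination with coefficients `1, r, r²` of three
instances of the hypothesis. -/
theorem strongLogConcave_mul_X_add_C {q : ℝ[X]} {r : ℝ} (hr : 0 ≤ r)
    (h0 : ∀ n, 0 ≤ q.coeff n)
    (h : ∀ j l : ℕ, q.coeff j * q.coeff (j + l + 2) ≤ q.coeff (j + 1) * q.coeff (j + l + 1)) :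
    (∀ n, 0 ≤ (q * (X + C r)).coeff n) ∧
      ∀ j l : ℕ, (q * (X + C r)).coeff j * (q * (X + C r)).coeff (j + l + 2) ≤
        (q * (X + C r)).coeff (j + 1) * (q * (X + C r)).coeff (j + l + 1) := by
  refine ⟨fun n => ?_, fun j l => ?_⟩
  · cases n with
    | zero => rw [coeff_mul_X_add_C_zero]; exact mul_nonneg hr (h0 0)
    | succ n =>
      rw [coeff_mul_X_add_C_succ]
      exact add_nonneg (h0 n) (mul_nonneg hr (h0 _))
  · cases j with
    | zero =>
      -- `p₀ p_{l+2} ≤ p₁ p_{l+1}`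
      rw [coeff_mul_X_add_C_zero, show 0 + l + 2 = (l + 1) + 1 by ring, coeff_mul_X_add_C_succ,
        show (0 : ℕ) + 1 = 0 + 1 from rfl, coeff_mul_X_add_C_succ,
        show 0 + l + 1 = l + 1 by ring, coeff_mul_X_add_C_succ]
      have h1 := h 0 l
      simp only [zero_add] at h1
      have hl2 : l + 1 + 1 = l + 2 := by ring
      rw [hl2]
      have e1 : 0 ≤ q.coeff 0 * q.coeff l := mul_nonneg (h0 0) (h0 l)
      have e2 : 0 ≤ r * (q.coeff 1 * q.coeff l) := mul_nonneg hr (mul_nonneg (h0 1) (h0 l))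
      have e3 : 0 ≤ r * r * (q.coeff 1 * q.coeff (l + 1) - q.coeff 0 * q.coeff (l + 2)) :=
        mul_nonneg (mul_nonneg hr hr) (by linarith)
      nlinarith [e1, e2, e3]
    | succ a =>
      rw [show a + 1 + l + 2 = (a + l + 2) + 1 by ring, show a + 1 + 1 = (a + 1) + 1 from rfl,
        show a + 1 + l + 1 = (a + l + 1) + 1 by ring, coeff_mul_X_add_C_succ,
        coeff_mul_X_add_C_succ, coeff_mul_X_add_C_succ, coeff_mul_X_add_C_succ]
      -- three instances of the hypothesis
      have i1 : q.coeff a * q.coeff (a + l + 2) ≤ q.coeff (a + 1) * q.coeff (a + l + 1) := h a l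
      have i3 : q.coeff (a + 1) * q.coeff (a + l + 3) ≤ q.coeff (a + 2) * q.coeff (a + l + 2) := by
        have := h (a + 1) l
        rwa [show a + 1 + l + 2 = a + l + 3 by ring, show a + 1 + 1 = a + 2 by ring,
          show a + 1 + l + 1 = a + l + 2 by ring] at this
      have i2 : q.coeff a * q.coeff (a + l + 3) ≤ q.coeff (a + 2) * q.coeff (a + l + 1) := by
        rcases Nat.eq_zero_or_pos l with rfl | hl
        · have := h a 1
          rw [show a + 1 + 2 = a + 0 + 3 by ring, show a + 1 + 1 = a + 2 by ring] at this
          rw [show a + 0 + 1 = a + 1 by ring, mul_comm (q.coeff (a + 2))]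
          exact this
        · obtain ⟨l', rfl⟩ : ∃ l', l = l' + 1 := ⟨l - 1, by omega⟩
          have hA := h a (l' + 2)
          rw [show a + (l' + 2) + 2 = a + (l' + 1) + 3 by ring,
            show a + (l' + 2) + 1 = a + l' + 3 by ring] at hA
          have hB := h (a + 1) l'
          rw [show a + 1 + l' + 2 = a + l' + 3 by ring, show a + 1 + 1 = a + 2 by ring,
            show a + 1 + l' + 1 = a + (l' + 1) + 1 by ring] at hB
          have hq2 : 0 ≤ q.coeff (a + 2) := h0 _
          have hq1 : 0 ≤ q.coeff (a + 1) := h0 _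
          -- `q_a q_{a+l+3} ≤ q_{a+1} q_{a+l'+3} ≤ ?` : chain the two
          by_cases hz : q.coeff (a + 1) = 0
          · -- then `q_a q_{a+l+3} ≤ 0`
            have : q.coeff a * q.coeff (a + (l' + 1) + 3) ≤ 0 := by rw [hz, zero_mul] at hA; exact hA
            exact this.trans (mul_nonneg hq2 (h0 _))
          · have hpos : 0 < q.coeff (a + 1) := lt_of_le_of_ne hq1 (Ne.symm hz)
            -- multiply `hB` by `q_a`-free manipulation: from hA and hB,
            -- q_a q_{a+l+3} * q_{a+1} ≤ q_{a+1} q_{a+l'+3} q_{a+1}... use nlinarith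
            have hA' : q.coeff a * q.coeff (a + (l' + 1) + 3) * q.coeff (a + 1) ≤
                q.coeff (a + 1) * q.coeff (a + l' + 3) * q.coeff (a + 1) :=
              mul_le_mul_of_nonneg_right hA hq1
            have hB' : q.coeff (a + 1) * q.coeff (a + l' + 3) * q.coeff (a + 1) ≤
                q.coeff (a + 2) * q.coeff (a + (l' + 1) + 1) * q.coeff (a + 1) := by
              have := mul_le_mul_of_nonneg_left hB hq1
              nlinarith [this]
            have := hA'.trans hB'
            rw [mul_le_mul_iff_of_pos_right hpos] at this
            exact this
      have hq0 := h0 a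
      have hq1 := h0 (a + 1)
      have hq2 := h0 (a + 2)
      have e2 : 0 ≤ r * (q.coeff (a + 2) * q.coeff (a + l + 1) - q.coeff a * q.coeff (a + l + 3)) :=
        mul_nonneg hr (by linarith)
      have e3 : 0 ≤ r * r *
          (q.coeff (a + 2) * q.coeff (a + l + 2) - q.coeff (a + 1) * q.coeff (a + l + 3)) :=
        mul_nonneg (mul_nonneg hr hr) (by linarith)
      rw [show a + l + 2 + 1 = a + l + 3 by ring, show a + 1 + 1 = a + 2 by ring,
        show a + l + 1 + 1 = a + l + 2 by ring]
      nlinarith [i1, e2, e3]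

/-- **Strong log-concavity of `a · ∏_{s ∈ S} (X + s)`** for `a ≥ 0` and a multiset `S` of
non-negative reals (induction on `S` from the constant polynomial). -/
theorem strongLogConcave_C_mul_prod_X_add_C {a : ℝ} (ha : 0 ≤ a) (S : Multiset ℝ)
    (hS : ∀ s ∈ S, 0 ≤ s) :
    (∀ n, 0 ≤ (C a * (S.map fun s => X + C s).prod).coeff n) ∧
      ∀ j l : ℕ, (C a * (S.map fun s => X + C s).prod).coeff j *
          (C a * (S.map fun s => X + C s).prod).coeff (j + l + 2) ≤
        (C a * (S.map fun s => X + C s).prod).coeff (j + 1) *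
          (C a * (S.map fun s => X + C s).prod).coeff (j + l + 1) := by
  induction S using Multiset.induction_on with
  | empty =>
    simp only [Multiset.map_zero, Multiset.prod_zero, mul_one, coeff_C]
    refine ⟨fun n => ?_, fun j l => ?_⟩
    · split_ifs <;> simp [ha]
    · simp
  | cons s S ih =>
    have hs : 0 ≤ s := hS s (Multiset.mem_cons_self s S)
    have hS' : ∀ x ∈ S, 0 ≤ x := fun x hx => hS x (Multiset.mem_cons_of_mem hx)
    obtain ⟨ih0, ih1⟩ := ih hS'
    have hstep := strongLogConcave_mul_X_add_C hs ih0 ih1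
    have heq : C a * ((s ::ₘ S).map fun s => X + C s).prod =
        C a * (S.map fun s => X + C s).prod * (X + C s) := by
      rw [Multiset.map_cons, Multiset.prod_cons]; ring
    rw [heq]
    exact hstep

/-- A real polynomial with non-negative coefficients, not the zero polynomial, has no positive
root. -/
theorem eval_pos_of_coeff_nonneg {P : ℝ[X]} (hP : P ≠ 0) (h0 : ∀ n, 0 ≤ P.coeff n) {x : ℝ}
    (hx : 0 < x) : 0 < P.eval x := by
  rw [eval_eq_sum_range]
  have hlead : 0 < P.coeff P.natDegree * x ^ P.natDegree := by
    refine mul_pos (lt_of_le_of_ne (h0 _) ?_) (pow_pos hx _)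
    exact fun h => hP (leadingCoeff_eq_zero.mp h.symm)
  refine lt_of_lt_of_le hlead (Finset.single_le_sum (f := fun i => P.coeff i * x ^ i)
    (fun i _ => mul_nonneg (h0 i) (pow_nonneg hx.le i)) ?_)
  exact Finset.mem_range.mpr (Nat.lt_succ_self _)

/-- **Real-rooted + non-negative coefficients ⇒ `a · ∏ (X + s)` with `a, s ≥ 0`.** If every complex
root of `P ≠ 0` is real, `P` splits over `ℝ`, and by `eval_pos_of_coeff_nonneg` its roots are `≤ 0`. -/
theorem eq_C_mul_prod_X_add_C_of_roots_real {P : ℝ[X]} (hP : P ≠ 0) (h0 : ∀ n, 0 ≤ P.coeff n)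
    (hroots : ∀ z : ℂ, (P.map (algebraMap ℝ ℂ)).eval z = 0 → z.im = 0) :
    ∃ S : Multiset ℝ, (∀ s ∈ S, 0 ≤ s) ∧
      P = C P.leadingCoeff * (S.map fun s => X + C s).prod := by
  have hsplitC : (P.map (algebraMap ℝ ℂ)).Splits := IsAlgClosed.splits _
  have hsplit : P.Splits := by
    refine Splits.of_splits_map (algebraMap ℝ ℂ) hsplitC fun z hz => ?_
    have hz' : (P.map (algebraMap ℝ ℂ)).eval z = 0 :=
      ((mem_roots (map_ne_zero hP)).1 hz)
    have him := hroots z hz'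
    exact ⟨z.re, Complex.ext (by simp) (by simp [him])⟩
  refine ⟨P.roots.map fun ρ => -ρ, fun s hs => ?_, ?_⟩
  · obtain ⟨ρ, hρ, rfl⟩ := Multiset.mem_map.1 hs
    have hroot : P.eval ρ = 0 := (mem_roots hP).1 hρ
    by_contra hneg
    have hρpos : 0 < ρ := by linarith
    exact (eval_pos_of_coeff_nonneg hP h0 hρpos).ne' hroot
  · conv_lhs => rw [hsplit.eq_prod_roots]
    congr 1
    rw [Multiset.map_map]
    congr 1
    refine Multiset.map_congr rfl fun ρ _ => ?_
    simp [sub_eq_add_neg]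

/-- **Newton's inequality (log-concavity form) for real-rooted polynomials with non-negative
coefficients**: `p_k p_{k+2} ≤ p_{k+1}²` for every `k`. -/
theorem coeff_mul_coeff_le_sq_of_roots_real (P : ℝ[X]) (h0 : ∀ n, 0 ≤ P.coeff n)
    (hroots : ∀ z : ℂ, (P.map (algebraMap ℝ ℂ)).eval z = 0 → z.im = 0) (k : ℕ) :
    P.coeff k * P.coeff (k + 2) ≤ P.coeff (k + 1) ^ 2 := by
  by_cases hP : P = 0
  · simp [hP]
  obtain ⟨S, hS, hPeq⟩ := eq_C_mul_prod_X_add_C_of_roots_real hP h0 hroots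
  have ha : 0 ≤ P.leadingCoeff := h0 _
  obtain ⟨-, h⟩ := strongLogConcave_C_mul_prod_X_add_C ha S hS
  have := h k 0
  rw [← hPeq] at this
  simpa [sq] using this

/-- **Packaged form for a finite family of monomials.** If `c_j ≥ 0` and the polynomial
`∑_{j ∈ s} c_j ζ^{e_j}` has only real zeros in `ℂ`, then its coefficient sequence
`p_m = ∑_{j ∈ s, e_j = m} c_j` satisfies `p_k p_{k+2} ≤ p_{k+1}²`. -/
theorem newton_filter_sum_sq {ι : Type*} (s : Finset ι) (c : ι → ℝ) (e : ι → ℕ)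
    (hc : ∀ j ∈ s, 0 ≤ c j)
    (hroots : ∀ z : ℂ, (∑ j ∈ s, (c j : ℂ) * z ^ (e j)) = 0 → z.im = 0) (k : ℕ) :
    (∑ j ∈ s.filter (fun j => e j = k), c j) * (∑ j ∈ s.filter (fun j => e j = k + 2), c j) ≤
      (∑ j ∈ s.filter (fun j => e j = k + 1), c j) ^ 2 := by
  classical
  set P : ℝ[X] := ∑ j ∈ s, C (c j) * X ^ (e j) with hPdef
  have hcoeff : ∀ m, P.coeff m = ∑ j ∈ s.filter (fun j => e j = m), c j := by
    intro m
    rw [hPdef, finsetSum_coeff, Finset.sum_filter]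
    refine Finset.sum_congr rfl fun j _ => ?_
    rw [coeff_C_mul_X_pow]
    by_cases h : e j = m
    · rw [if_pos h.symm, if_pos h]
    · rw [if_neg (Ne.symm h), if_neg h]
  have h0 : ∀ n, 0 ≤ P.coeff n := fun n => by
    rw [hcoeff]; exact Finset.sum_nonneg fun j hj => hc j (Finset.mem_filter.1 hj).1
  have hr : ∀ z : ℂ, (P.map (algebraMap ℝ ℂ)).eval z = 0 → z.im = 0 := by
    intro z hz
    apply hroots z
    rw [← hz, hPdef, Polynomial.map_sum, eval_finsetSum]
    refine Finset.sum_congr rfl fun j _ => ?_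
    simp
  have := coeff_mul_coeff_le_sq_of_roots_real P h0 hr k
  rwa [hcoeff, hcoeff, hcoeff] at this

end Summit.Parity.GeneralizedHardyLittlewood.Theorems.HyperbolicityClipsParity
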